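import Mathlib
import Summits.ValiantsHypothesis.ValiantsHypothesis.Theorems.KPlusLogSqLawStepToward

/-!
# The plateau length law `k ≤ d + 2` from the four-step law (conditional assembly)

Static path model of route `KPlusLogSqLaw` (lines `S_t(θ) = b t + s t * θ`, uppers = even indices; window
`[j, j+d]` separated at `θ` iff every odd line of the window lies strictly below every even one at `θ`; row
`j` STEPS iff windows `j`, `j+1` are both separated somewhere and never at a common point; a stepping row
MOVES RIGHT iff every point separating window `j` lies left of every point separating window `j+1`).
Helper theorems, zero crux credit; nothing here bears on `TropicalB` as evidence.

* `length_core` — the pure logic of the pencil proof (cell THEORY-NOTE-g22 §1): in a run of `k ≥ d+3`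
  consecutive stepping rows `a, …, a+k-1` with a direction dichotomy per row, the FOUR-STEP LAW (the two
  middle rows of any four consecutive stepping rows move the same way) propagates the direction of row
  `a+1` to row `a+d+1`, contradicting the PERIOD-`d` ANTISYMMETRY `dir (a+d+1) ≠ dir (a+1)`.
* `consecutive_steps_le_of_four` — the window-level statement: if windows `a, …, a+k` (odd reach `d`)
  are each separated somewhere, consecutive ones never at a common point, the two far lines `a+d+1`,
  `a+d+2` have distinct slopes, and the FOUR-STEP LAW holds along the run (hypothesis `hF`, window
  form), then `k ≤ d + 2`.  The antisymmetry is DISCHARGED here from laws C and C′ (`toward_*`,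
  `toward_rev_*` of `KPlusLogSqLawStepToward`): both read the same slope pair `(s (a+d+1), s (a+d+2))`
  and answer with opposite directions for rows `a+d+1` and `a+1`; the dichotomy is `step_slopes_*`.
  What remains for the unconditional law is the window-level FOUR-STEP LAW itself (affine cores in
  `KPlusLogSqLawStepFour`); the bound is attained for every odd `d ≥ 3` (`KPlusLogSqLawStepSharpAll`).
-/

set_option linter.dupNamespace false

namespace Summit.ValiantsHypothesis.ValiantsHypothesis.Theorems.KPlusLogSqLawStepLength

open Summit.ValiantsHypothesis.ValiantsHypothesis.Theorems.KPlusLogSqLawStepSlopes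
  (step_slopes_even step_slopes_odd)
open Summit.ValiantsHypothesis.ValiantsHypothesis.Theorems.KPlusLogSqLawStepToward
  (toward_even toward_odd toward_rev_even toward_rev_odd)

/-- Pure logic of the length law: directions `R`/`L` per row, a dichotomy on the stepping rows
`a ≤ j < a+k`, the four-step law on rows `i..i+3` of the run, and the antisymmetry between rows `a+1`
and `a+d+1` are contradictory once `d + 3 ≤ k`. -/
theorem length_core (R L : ℕ → Prop) (a d k : ℕ) (hk : d + 3 ≤ k)
    (hRL : ∀ j : ℕ, a ≤ j → j < a + k → R j ∨ L j)
    (hF : ∀ i : ℕ, a ≤ i → i + 4 ≤ a + k → ¬ (R (i + 1) ∧ L (i + 2)) ∧ ¬ (L (i + 1) ∧ R (i + 2)))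
    (hanti : ¬ (R (a + 1) ∧ R (a + d + 1)) ∧ ¬ (L (a + 1) ∧ L (a + d + 1))) : False := by
  have chainR : R (a + 1) → ∀ m : ℕ, m ≤ d → R (a + 1 + m) := by
    intro h0 m
    induction m with
    | zero =>
      intro
      simpa using h0
    | succ m ih =>
      intro hm
      have hprev := ih (by omega)
      have hFm := (hF (a + m) (by omega) (by omega)).1
      have e1 : a + m + 1 = a + 1 + m := by omega
      have e2 : a + m + 2 = a + 1 + (m + 1) := by omega
      rw [e1, e2] at hFm
      rcases hRL (a + 1 + (m + 1)) (by omega) (by omega) with h | h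
      · exact h
      · exact absurd ⟨hprev, h⟩ hFm
  have chainL : L (a + 1) → ∀ m : ℕ, m ≤ d → L (a + 1 + m) := by
    intro h0 m
    induction m with
    | zero =>
      intro
      simpa using h0
    | succ m ih =>
      intro hm
      have hprev := ih (by omega)
      have hFm := (hF (a + m) (by omega) (by omega)).2
      have e1 : a + m + 1 = a + 1 + m := by omega
      have e2 : a + m + 2 = a + 1 + (m + 1) := by omega
      rw [e1, e2] at hFm
      rcases hRL (a + 1 + (m + 1)) (by omega) (by omega) with h | h
      · exact absurd ⟨hprev, h⟩ hFm
      · exact h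
  have e : a + 1 + d = a + d + 1 := by omega
  rcases hRL (a + 1) (by omega) (by omega) with h | h
  · have h' := chainR h d le_rfl
    rw [e] at h'
    exact hanti.1 ⟨h, h'⟩
  · have h' := chainL h d le_rfl
    rw [e] at h'
    exact hanti.2 ⟨h, h'⟩

/-- Re-indexing of a window's bounds (`lo = lo'`, `hi = hi'`). -/
theorem sep_cast (s b : ℕ → ℝ) (lo hi lo' hi' : ℕ) (h1 : lo = lo') (h2 : hi = hi') (θ : ℝ)
    (hh : ∀ e o : ℕ, lo ≤ e → e ≤ hi → lo ≤ o → o ≤ hi → Even e → Odd o →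
      b o + s o * θ < b e + s e * θ) :
    ∀ e o : ℕ, lo' ≤ e → e ≤ hi' → lo' ≤ o → o ≤ hi' → Even e → Odd o →
      b o + s o * θ < b e + s e * θ := by
  intro e o g1 g2 g3 g4
  exact hh e o (by omega) (by omega) (by omega) (by omega)

/-- PLATEAU LENGTH LAW from the FOUR-STEP LAW: if the windows `a, …, a+k` of odd reach `d` are each
separated somewhere (`hsep`), consecutive ones never at a common point (`hdis`: rows `a, …, a+k-1`
step), the far lines `a+d+1`, `a+d+2` have distinct slopes (`hgen`), and along the run the two middle
rows of any four consecutive stepping rows move the same way (`hF`, the four-step law in window form),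
then `k ≤ d + 2`. -/
theorem consecutive_steps_le_of_four (s b : ℕ → ℝ) (a d k : ℕ) (hd : Odd d)
    (hgen : s (a + d + 1) ≠ s (a + d + 2))
    (hsep : ∀ j : ℕ, a ≤ j → j ≤ a + k → ∃ θ : ℝ,
      (∀ e o : ℕ, j ≤ e → e ≤ j + d → j ≤ o → o ≤ j + d → Even e → Odd o →
          b o + s o * θ < b e + s e * θ))
    (hdis : ∀ j : ℕ, a ≤ j → j < a + k → ∀ x : ℝ, ¬ (
      (∀ e o : ℕ, j ≤ e → e ≤ j + d → j ≤ o → o ≤ j + d → Even e → Odd o →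
          b o + s o * x < b e + s e * x) ∧
      (∀ e o : ℕ, j + 1 ≤ e → e ≤ j + 1 + d → j + 1 ≤ o → o ≤ j + 1 + d → Even e → Odd o →
          b o + s o * x < b e + s e * x)))
    (hF : ∀ i : ℕ, a ≤ i → i + 4 ≤ a + k →
      ¬ ((∀ θ θ' : ℝ, (∀ e o : ℕ, i + 1 ≤ e → e ≤ i + 1 + d → i + 1 ≤ o → o ≤ i + 1 + d → Even e → Odd o →
          b o + s o * θ < b e + s e * θ) →
        (∀ e o : ℕ, i + 2 ≤ e → e ≤ i + 2 + d → i + 2 ≤ o → o ≤ i + 2 + d → Even e → Odd o →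
          b o + s o * θ' < b e + s e * θ') → θ < θ') ∧
        (∀ θ θ' : ℝ, (∀ e o : ℕ, i + 2 ≤ e → e ≤ i + 2 + d → i + 2 ≤ o → o ≤ i + 2 + d → Even e → Odd o →
          b o + s o * θ < b e + s e * θ) →
        (∀ e o : ℕ, i + 3 ≤ e → e ≤ i + 3 + d → i + 3 ≤ o → o ≤ i + 3 + d → Even e → Odd o →
          b o + s o * θ' < b e + s e * θ') → θ' < θ)) ∧
      ¬ ((∀ θ θ' : ℝ, (∀ e o : ℕ, i + 1 ≤ e → e ≤ i + 1 + d → i + 1 ≤ o → o ≤ i + 1 + d → Even e → Odd o →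
          b o + s o * θ < b e + s e * θ) →
        (∀ e o : ℕ, i + 2 ≤ e → e ≤ i + 2 + d → i + 2 ≤ o → o ≤ i + 2 + d → Even e → Odd o →
          b o + s o * θ' < b e + s e * θ') → θ' < θ) ∧
        (∀ θ θ' : ℝ, (∀ e o : ℕ, i + 2 ≤ e → e ≤ i + 2 + d → i + 2 ≤ o → o ≤ i + 2 + d → Even e → Odd o →
          b o + s o * θ < b e + s e * θ) →
        (∀ e o : ℕ, i + 3 ≤ e → e ≤ i + 3 + d → i + 3 ≤ o → o ≤ i + 3 + d → Even e → Odd o →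
          b o + s o * θ' < b e + s e * θ') → θ < θ'))) :
    k ≤ d + 2 := by
  by_contra hk0
  have hk : d + 3 ≤ k := by omega
  -- the five stepping hypotheses of rows `a, a+1` in the lemma shape
  have hA : ∃ θ : ℝ, (∀ e o : ℕ, a ≤ e → e ≤ a + d → a ≤ o → o ≤ a + d → Even e → Odd o →
          b o + s o * θ < b e + s e * θ) :=
    hsep a le_rfl (by omega)
  have hB : ∃ θ : ℝ, (∀ e o : ℕ, a + 1 ≤ e → e ≤ a + d + 1 → a + 1 ≤ o → o ≤ a + d + 1 → Even e → Odd o →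
          b o + s o * θ < b e + s e * θ) := by
    obtain ⟨θ, h⟩ := hsep (a + 1) (by omega) (by omega)
    exact ⟨θ, sep_cast s b _ _ _ _ rfl (by omega) θ h⟩
  have hB' : ∃ θ : ℝ, (∀ e o : ℕ, a + 2 ≤ e → e ≤ a + d + 2 → a + 2 ≤ o → o ≤ a + d + 2 → Even e → Odd o →
          b o + s o * θ < b e + s e * θ) := by
    obtain ⟨θ, h⟩ := hsep (a + 2) (by omega) (by omega)
    exact ⟨θ, sep_cast s b _ _ _ _ rfl (by omega) θ h⟩
  have hAB : ∀ θ : ℝ, ¬ ((∀ e o : ℕ, a ≤ e → e ≤ a + d → a ≤ o → o ≤ a + d → Even e → Odd o →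
          b o + s o * θ < b e + s e * θ) ∧
      (∀ e o : ℕ, a + 1 ≤ e → e ≤ a + d + 1 → a + 1 ≤ o → o ≤ a + d + 1 → Even e → Odd o →
          b o + s o * θ < b e + s e * θ)) :=
    fun θ h => hdis a le_rfl (by omega) θ ⟨h.1, sep_cast s b _ _ _ _ rfl (by omega) θ h.2⟩
  have hBB' : ∀ θ : ℝ, ¬ ((∀ e o : ℕ, a + 1 ≤ e → e ≤ a + d + 1 → a + 1 ≤ o → o ≤ a + d + 1 → Even e → Odd o →
          b o + s o * θ < b e + s e * θ) ∧
      (∀ e o : ℕ, a + 2 ≤ e → e ≤ a + d + 2 → a + 2 ≤ o → o ≤ a + d + 2 → Even e → Odd o →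
          b o + s o * θ < b e + s e * θ)) :=
    fun θ h => hdis (a + 1) (by omega) (by omega) θ
      ⟨sep_cast s b _ _ _ _ rfl (by omega) θ h.1, sep_cast s b _ _ _ _ (by omega) (by omega) θ h.2⟩
  -- the five stepping hypotheses of rows `a+d+1, a+d+2` in the lemma shape
  have gA : ∃ θ : ℝ, (∀ e o : ℕ, a + d + 1 ≤ e → e ≤ a + d + 1 + d → a + d + 1 ≤ o → o ≤ a + d + 1 + d → Even e → Odd o →
          b o + s o * θ < b e + s e * θ) :=
    hsep (a + d + 1) (by omega) (by omega)
  have gB : ∃ θ : ℝ, (∀ e o : ℕ, a + d + 1 + 1 ≤ e → e ≤ a + d + 1 + d + 1 → a + d + 1 + 1 ≤ o → o ≤ a + d + 1 + d + 1 → Even e → Odd o →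
          b o + s o * θ < b e + s e * θ) := by
    obtain ⟨θ, h⟩ := hsep (a + d + 2) (by omega) (by omega)
    exact ⟨θ, sep_cast s b _ _ _ _ (by omega) (by omega) θ h⟩
  have gB' : ∃ θ : ℝ, (∀ e o : ℕ, a + d + 1 + 2 ≤ e → e ≤ a + d + 1 + d + 2 → a + d + 1 + 2 ≤ o → o ≤ a + d + 1 + d + 2 → Even e → Odd o →
          b o + s o * θ < b e + s e * θ) := by
    obtain ⟨θ, h⟩ := hsep (a + d + 3) (by omega) (by omega)
    exact ⟨θ, sep_cast s b _ _ _ _ (by omega) (by omega) θ h⟩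
  have gAB : ∀ θ : ℝ, ¬ ((∀ e o : ℕ, a + d + 1 ≤ e → e ≤ a + d + 1 + d → a + d + 1 ≤ o → o ≤ a + d + 1 + d → Even e → Odd o →
          b o + s o * θ < b e + s e * θ) ∧
      (∀ e o : ℕ, a + d + 1 + 1 ≤ e → e ≤ a + d + 1 + d + 1 → a + d + 1 + 1 ≤ o → o ≤ a + d + 1 + d + 1 → Even e → Odd o →
          b o + s o * θ < b e + s e * θ)) :=
    fun θ h => hdis (a + d + 1) (by omega) (by omega) θ
      ⟨h.1, sep_cast s b _ _ _ _ (by omega) (by omega) θ h.2⟩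
  have gBB' : ∀ θ : ℝ, ¬ ((∀ e o : ℕ, a + d + 1 + 1 ≤ e → e ≤ a + d + 1 + d + 1 → a + d + 1 + 1 ≤ o → o ≤ a + d + 1 + d + 1 → Even e → Odd o →
          b o + s o * θ < b e + s e * θ) ∧
      (∀ e o : ℕ, a + d + 1 + 2 ≤ e → e ≤ a + d + 1 + d + 2 → a + d + 1 + 2 ≤ o → o ≤ a + d + 1 + d + 2 → Even e → Odd o →
          b o + s o * θ < b e + s e * θ)) :=
    fun θ h => hdis (a + d + 2) (by omega) (by omega) θ
      ⟨sep_cast s b _ _ _ _ (by omega) (by omega) θ h.1,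
        sep_cast s b _ _ _ _ (by omega) (by omega) θ h.2⟩
  -- exclusivity of the two directions at a row whose two windows are nonempty
  have excl : ∀ j : ℕ, a ≤ j → j < a + k →
      (∀ θ θ' : ℝ, (∀ e o : ℕ, j ≤ e → e ≤ j + d → j ≤ o → o ≤ j + d → Even e → Odd o →
          b o + s o * θ < b e + s e * θ) →
        (∀ e o : ℕ, j + 1 ≤ e → e ≤ j + 1 + d → j + 1 ≤ o → o ≤ j + 1 + d → Even e → Odd o →
          b o + s o * θ' < b e + s e * θ') → θ < θ') →
      (∀ θ θ' : ℝ, (∀ e o : ℕ, j ≤ e → e ≤ j + d → j ≤ o → o ≤ j + d → Even e → Odd o →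
          b o + s o * θ < b e + s e * θ) →
        (∀ e o : ℕ, j + 1 ≤ e → e ≤ j + 1 + d → j + 1 ≤ o → o ≤ j + 1 + d → Even e → Odd o →
          b o + s o * θ' < b e + s e * θ') → θ' < θ) → False := by
    intro j h1 h2 hr hl
    obtain ⟨θ, hθ⟩ := hsep j h1 (by omega)
    obtain ⟨θ', hθ'⟩ := hsep (j + 1) (by omega) (by omega)
    exact lt_asymm (hr θ θ' hθ hθ') (hl θ θ' hθ hθ')
  refine length_core
    (fun j => (∀ θ θ' : ℝ, (∀ e o : ℕ, j ≤ e → e ≤ j + d → j ≤ o → o ≤ j + d → Even e → Odd o →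
          b o + s o * θ < b e + s e * θ) →
        (∀ e o : ℕ, j + 1 ≤ e → e ≤ j + 1 + d → j + 1 ≤ o → o ≤ j + 1 + d → Even e → Odd o →
          b o + s o * θ' < b e + s e * θ') → θ < θ'))
    (fun j => (∀ θ θ' : ℝ, (∀ e o : ℕ, j ≤ e → e ≤ j + d → j ≤ o → o ≤ j + d → Even e → Odd o →
          b o + s o * θ < b e + s e * θ) →
        (∀ e o : ℕ, j + 1 ≤ e → e ≤ j + 1 + d → j + 1 ≤ o → o ≤ j + 1 + d → Even e → Odd o →
          b o + s o * θ' < b e + s e * θ') → θ' < θ))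
    a d k hk ?_ hF ?_
  · -- direction dichotomy of a stepping row (`step_slopes_*`)
    intro j h1 h2
    have jA : ∃ θ : ℝ, (∀ e o : ℕ, j ≤ e → e ≤ j + d → j ≤ o → o ≤ j + d → Even e → Odd o →
          b o + s o * θ < b e + s e * θ) := hsep j h1 (by omega)
    have jB : ∃ θ : ℝ, (∀ e o : ℕ, j + 1 ≤ e → e ≤ j + d + 1 → j + 1 ≤ o → o ≤ j + d + 1 → Even e → Odd o →
          b o + s o * θ < b e + s e * θ) := by
      obtain ⟨θ, h⟩ := hsep (j + 1) (by omega) (by omega)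
      exact ⟨θ, sep_cast s b _ _ _ _ rfl (by omega) θ h⟩
    have jAB : ∀ θ : ℝ, ¬ ((∀ e o : ℕ, j ≤ e → e ≤ j + d → j ≤ o → o ≤ j + d → Even e → Odd o →
          b o + s o * θ < b e + s e * θ) ∧
        (∀ e o : ℕ, j + 1 ≤ e → e ≤ j + d + 1 → j + 1 ≤ o → o ≤ j + d + 1 → Even e → Odd o →
          b o + s o * θ < b e + s e * θ)) :=
      fun θ h => hdis j h1 h2 θ ⟨h.1, sep_cast s b _ _ _ _ rfl (by omega) θ h.2⟩
    rcases Nat.even_or_odd j with hj | hj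
    · obtain ⟨o, o', -, -, -, -, -, -, hdir⟩ := step_slopes_even s b j d hj hd jA jB jAB
      rcases hdir with ⟨-, -, hR⟩ | ⟨-, -, hL⟩
      · exact Or.inl fun θ θ' hθ hθ' => hR θ θ' hθ (sep_cast s b _ _ _ _ rfl (by omega) θ' hθ')
      · exact Or.inr fun θ θ' hθ hθ' => hL θ θ' hθ (sep_cast s b _ _ _ _ rfl (by omega) θ' hθ')
    · obtain ⟨e, e', -, -, -, -, -, -, hdir⟩ := step_slopes_odd s b j d hj hd jA jB jAB
      rcases hdir with ⟨-, -, hR⟩ | ⟨-, -, hL⟩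
      · exact Or.inl fun θ θ' hθ hθ' => hR θ θ' hθ (sep_cast s b _ _ _ _ rfl (by omega) θ' hθ')
      · exact Or.inr fun θ θ' hθ hθ' => hL θ θ' hθ (sep_cast s b _ _ _ _ rfl (by omega) θ' hθ')
  · -- antisymmetry between rows `a+1` and `a+d+1` from laws C′ (near pair of rows) and C (far pair)
    have ex1 := excl (a + 1) (by omega) (by omega)
    have ex2 := excl (a + d + 1) (by omega) (by omega)
    rcases Nat.even_or_odd a with ha | ha
    · have hpar : Even (a + d + 1) := by
        obtain ⟨p, hp⟩ := ha
        obtain ⟨q, hq⟩ := hd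
        exact ⟨p + q + 1, by omega⟩
      have T1 := toward_rev_even s b a d ha hd hA hB hAB hB' hBB'
      have T2 := toward_even s b (a + d + 1) d hpar hd gA gB gAB gB' gBB'
      rcases lt_or_gt_of_ne hgen with hlt | hgt
      · have L1 : (∀ θ θ' : ℝ, (∀ e o : ℕ, a + 1 ≤ e → e ≤ a + 1 + d → a + 1 ≤ o → o ≤ a + 1 + d → Even e → Odd o →
          b o + s o * θ < b e + s e * θ) →
        (∀ e o : ℕ, a + 1 + 1 ≤ e → e ≤ a + 1 + 1 + d → a + 1 + 1 ≤ o → o ≤ a + 1 + 1 + d → Even e → Odd o →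
          b o + s o * θ' < b e + s e * θ') → θ' < θ) :=
          fun θ θ' hθ hθ' => T1.2 hlt θ θ' (sep_cast s b _ _ _ _ rfl (by omega) θ hθ)
            (sep_cast s b _ _ _ _ (by omega) (by omega) θ' hθ')
        have R2 : (∀ θ θ' : ℝ, (∀ e o : ℕ, a + d + 1 ≤ e → e ≤ a + d + 1 + d → a + d + 1 ≤ o → o ≤ a + d + 1 + d → Even e → Odd o →
          b o + s o * θ < b e + s e * θ) →
        (∀ e o : ℕ, a + d + 1 + 1 ≤ e → e ≤ a + d + 1 + 1 + d → a + d + 1 + 1 ≤ o → o ≤ a + d + 1 + 1 + d → Even e → Odd o →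
          b o + s o * θ' < b e + s e * θ') → θ < θ') :=
          fun θ θ' hθ hθ' => T2.2 hlt θ θ' hθ (sep_cast s b _ _ _ _ (by omega) (by omega) θ' hθ')
        exact ⟨fun h => ex1 h.1 L1, fun h => ex2 R2 h.2⟩
      · have R1 : (∀ θ θ' : ℝ, (∀ e o : ℕ, a + 1 ≤ e → e ≤ a + 1 + d → a + 1 ≤ o → o ≤ a + 1 + d → Even e → Odd o →
          b o + s o * θ < b e + s e * θ) →
        (∀ e o : ℕ, a + 1 + 1 ≤ e → e ≤ a + 1 + 1 + d → a + 1 + 1 ≤ o → o ≤ a + 1 + 1 + d → Even e → Odd o →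
          b o + s o * θ' < b e + s e * θ') → θ < θ') :=
          fun θ θ' hθ hθ' => T1.1 hgt θ θ' (sep_cast s b _ _ _ _ rfl (by omega) θ hθ)
            (sep_cast s b _ _ _ _ (by omega) (by omega) θ' hθ')
        have L2 : (∀ θ θ' : ℝ, (∀ e o : ℕ, a + d + 1 ≤ e → e ≤ a + d + 1 + d → a + d + 1 ≤ o → o ≤ a + d + 1 + d → Even e → Odd o →
          b o + s o * θ < b e + s e * θ) →
        (∀ e o : ℕ, a + d + 1 + 1 ≤ e → e ≤ a + d + 1 + 1 + d → a + d + 1 + 1 ≤ o → o ≤ a + d + 1 + 1 + d → Even e → Odd o →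
          b o + s o * θ' < b e + s e * θ') → θ' < θ) :=
          fun θ θ' hθ hθ' => T2.1 hgt θ θ' hθ (sep_cast s b _ _ _ _ (by omega) (by omega) θ' hθ')
        exact ⟨fun h => ex2 h.2 L2, fun h => ex1 R1 h.1⟩
    · have hpar : Odd (a + d + 1) := by
        obtain ⟨p, hp⟩ := ha
        obtain ⟨q, hq⟩ := hd
        exact ⟨p + q + 1, by omega⟩
      have T1 := toward_rev_odd s b a d ha hd hA hB hAB hB' hBB'
      have T2 := toward_odd s b (a + d + 1) d hpar hd gA gB gAB gB' gBB'
      rcases lt_or_gt_of_ne hgen with hlt | hgt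
      · have R1 : (∀ θ θ' : ℝ, (∀ e o : ℕ, a + 1 ≤ e → e ≤ a + 1 + d → a + 1 ≤ o → o ≤ a + 1 + d → Even e → Odd o →
          b o + s o * θ < b e + s e * θ) →
        (∀ e o : ℕ, a + 1 + 1 ≤ e → e ≤ a + 1 + 1 + d → a + 1 + 1 ≤ o → o ≤ a + 1 + 1 + d → Even e → Odd o →
          b o + s o * θ' < b e + s e * θ') → θ < θ') :=
          fun θ θ' hθ hθ' => T1.1 hlt θ θ' (sep_cast s b _ _ _ _ rfl (by omega) θ hθ)
            (sep_cast s b _ _ _ _ (by omega) (by omega) θ' hθ')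
        have L2 : (∀ θ θ' : ℝ, (∀ e o : ℕ, a + d + 1 ≤ e → e ≤ a + d + 1 + d → a + d + 1 ≤ o → o ≤ a + d + 1 + d → Even e → Odd o →
          b o + s o * θ < b e + s e * θ) →
        (∀ e o : ℕ, a + d + 1 + 1 ≤ e → e ≤ a + d + 1 + 1 + d → a + d + 1 + 1 ≤ o → o ≤ a + d + 1 + 1 + d → Even e → Odd o →
          b o + s o * θ' < b e + s e * θ') → θ' < θ) :=
          fun θ θ' hθ hθ' => T2.1 hlt θ θ' hθ (sep_cast s b _ _ _ _ (by omega) (by omega) θ' hθ')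
        exact ⟨fun h => ex2 h.2 L2, fun h => ex1 R1 h.1⟩
      · have L1 : (∀ θ θ' : ℝ, (∀ e o : ℕ, a + 1 ≤ e → e ≤ a + 1 + d → a + 1 ≤ o → o ≤ a + 1 + d → Even e → Odd o →
          b o + s o * θ < b e + s e * θ) →
        (∀ e o : ℕ, a + 1 + 1 ≤ e → e ≤ a + 1 + 1 + d → a + 1 + 1 ≤ o → o ≤ a + 1 + 1 + d → Even e → Odd o →
          b o + s o * θ' < b e + s e * θ') → θ' < θ) :=
          fun θ θ' hθ hθ' => T1.2 hgt θ θ' (sep_cast s b _ _ _ _ rfl (by omega) θ hθ)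
            (sep_cast s b _ _ _ _ (by omega) (by omega) θ' hθ')
        have R2 : (∀ θ θ' : ℝ, (∀ e o : ℕ, a + d + 1 ≤ e → e ≤ a + d + 1 + d → a + d + 1 ≤ o → o ≤ a + d + 1 + d → Even e → Odd o →
          b o + s o * θ < b e + s e * θ) →
        (∀ e o : ℕ, a + d + 1 + 1 ≤ e → e ≤ a + d + 1 + 1 + d → a + d + 1 + 1 ≤ o → o ≤ a + d + 1 + 1 + d → Even e → Odd o →
          b o + s o * θ' < b e + s e * θ') → θ < θ') :=
          fun θ θ' hθ hθ' => T2.2 hgt θ θ' hθ (sep_cast s b _ _ _ _ (by omega) (by omega) θ' hθ')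
        exact ⟨fun h => ex1 h.1 L1, fun h => ex2 R2 h.2⟩

end Summit.ValiantsHypothesis.ValiantsHypothesis.Theorems.KPlusLogSqLawStepLength
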